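import Summits.HodgeConjecture.CorCM.IrreducibleOddWeightsRankSubsetSum
import Summits.HodgeConjecture.CorCM.IrreducibleOddWeightsCMFields
import HarnessLib

/-!
# CM fields with irreducible odd weights: the rank of a family of CM types is a subset sum of the members' ranks —
# for ONE field, `dim Hg(A_1 × ⋯ × A_k) ∈ n·ℕ`

COR-CM (cell `pub-hodgecm2`, binder seat `b16` gen 55, count-neutral claim IRR-ODD, file F6b — the CM-field dress of F6
`CorCM/IrreducibleOddWeightsRankSubsetSum`; theorems only, no definition, no named fact, no `sorry`).  NEW as stated,
hence under `Summits/`.  HONEST FRAMING: statements about the rank `cmFamilyRank Φ` of a family of CM types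
(`= dim MT(⊕_i H¹(A_i))` for realisations `A_i`, tree `mtRank_pi_bettiHodge_eq_cmFamilyRank_holds`, seat b27); `HC_CM`
is neither used nor asserted.

* **`exists_cmFamilyRank_add_card_eq_sum_of_irreducible`** — CM fields `K_i` all with irreducible odd weights ((IRR);
  e.g. all (SC): pair-flip, double-flip, … fields — any mixture, any degrees), any CM types `Φ_i`: for some set of slots
  `T`, `rank(Φ) − 1 = Σ_{i∈T} (rank(Φ_i) − 1) = Σ_{i∈T} [K_i:ℚ]/2` (`exists_cmFamilyRank_eq_sum_finrank_of_irreducible`):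
  `dim Hg(∏_i A_i)` is a SUBSET SUM of the `dim A_i`.
* **`exists_cmFamilyRank_eq_mul_of_irreducible`** — ONE (IRR) field `K` of degree `2n`, any types:
  `rank(Φ) = r·n + 1` with `r ≤ |I|` (`finrank_div_two_dvd_cmFamilyRank_sub_one_of_irreducible`: `n ∣ rank − 1`);
  `r = |I|` iff the family is nondegenerate (then `2|I| ≤ n` off (SC), F5b).  E.g. octic (IRR) non-(SC) fields
  (`n = 4`, capacity `2`): every triple of types has `rank − 1 ∈ {4, 8}` — numerics (`lean-g55/octic16.out`): for the
  `D₁₆`/`SD₁₆`/`M₁₆`-octics all 84 triples of pairwise non-opposite types have `rank − 1 = 8`, and for `SD₁₆` all 14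
  non-opposite pairs are additive (pairwise `Hg(A×B) = Hg(A)×Hg(B)` for three pairwise non-isogenous simple CM
  fourfolds, yet `dim Hg(A×B×C) = 8 < 12`).

## References

* [Gordon1999HodgeAVSurvey] B. B. Gordon, *A survey of the Hodge conjecture for abelian varieties*, §3 Theorem (proof),
  7.5–7.7, 9.1.
* [Deligne1982HodgeCycles] P. Deligne, *Hodge cycles on abelian varieties*, LNM 900 (1982), I Ex. 3.7 (c).
* [Serre1977] J.-P. Serre, *Linear Representations of Finite Groups*, GTM 42 (1977), §2.2.
-/

set_option autoImplicit false

noncomputable section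

open CategoryTheory CategoryTheory.Limits NumberField

namespace Summit.HodgeConjecture.CorCM

open Literature.NumberTheory.ComplexMultiplication
open Literature.AlgebraicGeometry.Motives (AbelianVariety CMType)
open Literature.AlgebraicGeometry.HodgeTheory
open Literature.AlgebraicGeometry.Pohlmann1968
open GenericCMField

/-! ## §1 Several (IRR) fields: subset sums -/

section Several

variable {I : Type} [Fintype I] [DecidableEq I] {K : I → Type} [∀ i, Field (K i)] [∀ i, NumberField (K i)]
  [∀ i, IsCMField (K i)]

/-- **CM fields with irreducible odd weights: `rank(Φ) + |T| = Σ_{i∈T} rank(Φ_i) + 1` for some set of slots `T`**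
(`dim Hg(∏ A_i) = Σ_{i∈T} dim Hg(A_i)`). [cite: Gordon1999HodgeAVSurvey, §3 Theorem (proof) and 7.5–7.7] -/
theorem exists_cmFamilyRank_add_card_eq_sum_of_irreducible [Nonempty I]
    (hirr : ∀ i, ∀ W : Submodule ℚ ((K i →+* ℂ) → ℚ), W ≤ antiWeights (E := K i →+* ℂ) (starRingAut : ℂ ≃+* ℂ) →
      W ≠ ⊥ → (∀ (k : ℂ ≃+* ℂ) (f : (K i →+* ℂ) → ℚ), f ∈ W → (fun y => f (k • y)) ∈ W) →
      W = antiWeights (E := K i →+* ℂ) (starRingAut : ℂ ≃+* ℂ))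
    (Φ : ∀ i, CMType (K i)) :
    ∃ T : Finset I, CMAlgebra.cmFamilyRank Φ + T.card = (∑ i ∈ T, cmTypeRank (Φ i)) + 1 :=
  IrrOdd.exists_typeRank_sigmaType_add_card_eq_sum (G := ℂ ≃+* ℂ) (Φ := fun i => (Φ i).1)
    (fun i => isCMTypeWith_conj (Φ i))
    fun i => IrrOdd.antiSpan_irreducible_of_irreducible (isCMTypeWith_conj (Φ i)) (hirr i)

/-- **… with the members' ranks evaluated: `rank(Φ) = Σ_{i∈T} [K_i:ℚ]/2 + 1`** (every CM type of an (IRR) field is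
nondegenerate, F2) — `dim Hg(∏_i A_i)` is a subset sum of the `dim A_i`.
[cite: Gordon1999HodgeAVSurvey, §3 Theorem (proof), 7.5–7.7 and 9.1] -/
theorem exists_cmFamilyRank_eq_sum_finrank_of_irreducible [Nonempty I]
    (hirr : ∀ i, ∀ W : Submodule ℚ ((K i →+* ℂ) → ℚ), W ≤ antiWeights (E := K i →+* ℂ) (starRingAut : ℂ ≃+* ℂ) →
      W ≠ ⊥ → (∀ (k : ℂ ≃+* ℂ) (f : (K i →+* ℂ) → ℚ), f ∈ W → (fun y => f (k • y)) ∈ W) →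
      W = antiWeights (E := K i →+* ℂ) (starRingAut : ℂ ≃+* ℂ))
    (Φ : ∀ i, CMType (K i)) :
    ∃ T : Finset I, CMAlgebra.cmFamilyRank Φ = (∑ i ∈ T, Module.finrank ℚ (K i) / 2) + 1 := by
  obtain ⟨T, hT⟩ := exists_cmFamilyRank_add_card_eq_sum_of_irreducible hirr Φ
  refine ⟨T, ?_⟩
  have hmem : ∀ i, cmTypeRank (Φ i) = Module.finrank ℚ (K i) / 2 + 1 := fun i =>
    (isNondegenerate_iff (Φ i)).1 (isNondegenerate_of_irreducible (hirr i) (Φ i))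
  rw [Finset.sum_congr rfl fun i _ => hmem i, Finset.sum_add_distrib, Finset.sum_const, smul_eq_mul, mul_one] at hT
  omega

end Several

/-! ## §2 One (IRR) field: multiples of `n` -/

section One

variable {K : Type} [Field K] [NumberField K] [IsCMField K] {I : Type} [Fintype I] [DecidableEq I] [Nonempty I]

/-- **ONE (IRR) FIELD `K` OF DEGREE `2n`: `rank(Φ) = r·n + 1` with `r ≤ |I|`** for EVERY family of CM types of `K` —
`dim Hg(A_1 × ⋯ × A_k) − ` … is a multiple of `n = dim A_i` for abelian varieties with CM by `K`; `r = |I|` iff the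
family is nondegenerate. [cite: Gordon1999HodgeAVSurvey, §3 Theorem (proof), 7.5–7.7 and 9.1] -/
theorem exists_cmFamilyRank_eq_mul_of_irreducible
    (hirr : ∀ W : Submodule ℚ ((K →+* ℂ) → ℚ), W ≤ antiWeights (E := K →+* ℂ) (starRingAut : ℂ ≃+* ℂ) → W ≠ ⊥ →
      (∀ (k : ℂ ≃+* ℂ) (f : (K →+* ℂ) → ℚ), f ∈ W → (fun y => f (k • y)) ∈ W) →
      W = antiWeights (E := K →+* ℂ) (starRingAut : ℂ ≃+* ℂ))
    (Φ : I → CMType K) :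
    ∃ r : ℕ, r ≤ Fintype.card I ∧
      CMAlgebra.cmFamilyRank (K := fun _ : I => K) Φ = r * (Module.finrank ℚ K / 2) + 1 := by
  rw [cmFamilyRank_eq_typeRank_sigmaType, ← Embeddings.card K ℂ]
  exact IrrOdd.exists_typeRank_sigmaType_eq_mul_add_one (G := ℂ ≃+* ℂ) (fun i => (Φ i).1)
    (fun i => isCMTypeWith_conj (Φ i)) hirr

/-- **Divisibility form: `[K:ℚ]/2 ∣ rank(Φ) − 1`** for every family of CM types of one (IRR) field.
[cite: Gordon1999HodgeAVSurvey, §3 Theorem (proof) and 9.1] -/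
theorem finrank_div_two_dvd_cmFamilyRank_sub_one_of_irreducible
    (hirr : ∀ W : Submodule ℚ ((K →+* ℂ) → ℚ), W ≤ antiWeights (E := K →+* ℂ) (starRingAut : ℂ ≃+* ℂ) → W ≠ ⊥ →
      (∀ (k : ℂ ≃+* ℂ) (f : (K →+* ℂ) → ℚ), f ∈ W → (fun y => f (k • y)) ∈ W) →
      W = antiWeights (E := K →+* ℂ) (starRingAut : ℂ ≃+* ℂ))
    (Φ : I → CMType K) :
    Module.finrank ℚ K / 2 ∣ CMAlgebra.cmFamilyRank (K := fun _ : I => K) Φ - 1 := by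
  obtain ⟨r, -, hr⟩ := exists_cmFamilyRank_eq_mul_of_irreducible hirr Φ
  exact ⟨r, by rw [hr, Nat.add_sub_cancel, mul_comm]⟩

/-- **Pairs and triples over an (IRR) field that is NOT (SC), `[K:ℚ] = 8`**: every family of at most three CM types
has `rank ≤ 9` with `4 ∣ rank − 1` — never `13`: a third simple CM fourfold with CM by `K` never enlarges the Hodge
group of a nondegenerate pair by its own `4` dimensions (`r = 3` would make the family nondegenerate, against
`2|I| ≤ 4` off (SC), F2). [cite: Gordon1999HodgeAVSurvey, 7.5–7.7 and 9.1] -/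
theorem cmFamilyRank_le_nine_of_irreducible_of_not_stabConj (h8 : Module.finrank ℚ K = 8)
    (hirr : ∀ W : Submodule ℚ ((K →+* ℂ) → ℚ), W ≤ antiWeights (E := K →+* ℂ) (starRingAut : ℂ ≃+* ℂ) → W ≠ ⊥ →
      (∀ (k : ℂ ≃+* ℂ) (f : (K →+* ℂ) → ℚ), f ∈ W → (fun y => f (k • y)) ∈ W) →
      W = antiWeights (E := K →+* ℂ) (starRingAut : ℂ ≃+* ℂ))
    (hnSC : ¬ ∀ x₀ x : K →+* ℂ, x ≠ x₀ → x ≠ (starRingAut : ℂ ≃+* ℂ) • x₀ →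
      ∃ σ : ℂ ≃+* ℂ, σ • x₀ = x₀ ∧ σ • x = (starRingAut : ℂ ≃+* ℂ) • x)
    (Φ : I → CMType K) (h3 : Fintype.card I ≤ 3) :
    CMAlgebra.cmFamilyRank (K := fun _ : I => K) Φ ≤ 9 ∧ 4 ∣ CMAlgebra.cmFamilyRank (K := fun _ : I => K) Φ - 1 := by
  obtain ⟨r, hr, hrank⟩ := exists_cmFamilyRank_eq_mul_of_irreducible hirr Φ
  rw [h8] at hrank
  have hr2 : r ≤ 2 := by
    by_contra hr2
    have hr3 : r = 3 := by omega
    have hI : Fintype.card I = 3 := by omega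
    have hnd : CMAlgebra.IsNondegenerateFamily (K := fun _ : I => K) Φ := by
      rw [CMAlgebra.isNondegenerateFamily_iff, hrank, hr3]
      norm_num [Finset.sum_const, Finset.card_univ, hI, h8]
    have h := two_mul_card_le_of_irreducible_of_not_stabConj hirr hnSC hnd
    rw [h8, hI] at h
    omega
  refine ⟨by rw [hrank]; omega, r, ?_⟩
  rw [hrank, Nat.add_sub_cancel, mul_comm]

end One

end Summit.HodgeConjecture.CorCM

end
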